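import Summits.Ventures.LatticeQCDFlow.Exactness.ReversibleAbelFloors
import HarnessLib

/-!
# The variational floor is SHARP: the Abel autocorrelation sum IS the supremum over trial observables, attained along the partial Neumann sums

HONEST FRAMING: exact (Metropolis-corrected) sampling algorithms for lattice gauge theory;
figures of merit are autocorrelation/cost numbers at stated couplings and volumes; no
continuum-physics claim.  (SCALAR calibration rung S0-A: not a gauge result.)

Venture `LatticeQCDFlow` (cell pub-lqcd), topic `Exactness`; FANOUT row 2 (`s0-phi4`).  NEW WORK
of the cell over `Exactness/ReversibleNeumannSums.lean` / `ReversibleVariationalFloor.lean` /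
`ReversibleAbelFloors.lean` (the format `RevOp` of a reversible exact sampler: weight `w ≥ 0`,
admissible class `A`, operator `K` with (int) (comb) (stab) (lin) (symm) (contr); instances in the
tree: the random-site-scan Metropolis `metroScan`, every HMC-type update `hmcOpOf`/`hmcOpPhi4`, the
randomised HMC `hmcOpRandom`, the flow sampler `imhOp`).  Only limits of real sequences are used (no
spectral theorem, no resolvent, no completeness of the class).  Nothing is cited as a fact.  Printed
counterparts, NAMED ONLY: the variational (`H₋₁`) formula for the asymptotic variance of a reversible
Markov chain (Kipnis–Varadhan 1986, Comm. Math. Phys. 104; Caracciolo–Pelissetto–Sokal 1990, J. Stat.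
Phys. 60, for trial-function bounds on autocorrelation times), in which the supremum is attained at
the solution of the Poisson (resolvent) equation.

## Why this file

`ReversibleVariationalFloor.lean` proved the test-function SIDE of the formula, in Abel form and
unconditionally: `(∫ g v w)² ≤ A_r(g) · Q_r(v)` for every `g, v ∈ A`, `0 ≤ r < 1`
(`A_r(g) = Σ_k C_g(k) rᵏ`, `Q_r(v) = ∫ v² w − r ∫ v (K v) w`), and listed the EQUALITY as not
claimed ("needs the Poisson equation / resolvent in the class").  It does not: the partial Neumann
sums `S_N = Σ_{k<N} rᵏ Kᵏ g`, which ARE in the class, satisfy `∫ g S_N w → A_r(g)` and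
`Q_r(S_N) → A_r(g)`, so the ratio `(∫ g S_N w)²/Q_r(S_N)` tends to `A_r(g)`: the supremum over the
admissible class equals the Abel sum (approached, not attained).  Consequently `A_r(g)` is the LEAST
constant `B ≥ 0` with `(∫ g v w)² ≤ B · Q_r(v)` on `A` — the form used by the comparison theorem
(`Exactness/ReversibleComparison.lean`) and by the Poincaré ceiling
(`Exactness/ReversiblePoincareCeiling.lean`).  The `r = 1` statement under summability
(`τ_int + ½` is the supremum) is `Exactness/ReversibleVariationalSupTauInt.lean`.

## What is proved (namespace `RevOp`; `C(k) = C_g(k) = ∫ g (Kᵏ g) w`)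

* `integral_neumann_mul`, `integral_mul_neumann` — `∫ S_N g w = ∫ g S_N w = Σ_{k<N} C(k) rᵏ`;
  `neumann_quadForm_eq` — `Q_r(S_N) = Σ_{k<N} C(k) rᵏ − r^N Σ_{k<N} C(N+k) rᵏ` (every real `r`);
  `tendsto_integral_neumann_mul`, `tendsto_neumann_quadForm` — both tend to `A_r(g)` (`0 ≤ r < 1`);
* **`abelSum_le_of_forall_sq_inner_le`** — if `0 ≤ B` and `(∫ g v w)² ≤ B · Q_r(v)` for all
  `v ∈ A`, then `A_r(g) ≤ B`;  `sq_inner_div_quadForm_le_abelSum` — each ratio is `≤ A_r(g)`;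
* **`abelSum_eq_iSup`** — THE VARIATIONAL FORMULA IN ABEL FORM:
  `A_r(g) = ⨆_{v ∈ A} (∫ g v w)² / Q_r(v)` for every `g ∈ A`, `0 ≤ r < 1` (Lean's `x/0 = 0` is
  harmless: `Q_r(v) = 0` forces `∫ g v w = 0`).

Reading (no numerics implied): every `τ_int` floor of HOME/s0-phi4/*-THEOREMS.md is a choice of
trial observable in ONE formula, and that formula is exact — a floor is loose only because the
trial observable is.  NOT CLAIMED: attainment of the supremum inside `A`; non-reversible updates;
any number for any run.
-/

namespace Summit.Ventures.LatticeQCDFlow.Exactness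

open Real MeasureTheory Filter Finset Topology
open Summit.Ventures.LatticeQCDFlow.Scoring

namespace RevOp

variable {X : Type*} [MeasurableSpace X] {μ : Measure X} {w : X → ℝ} {A : (X → ℝ) → Prop}
  {K : (X → ℝ) → (X → ℝ)}

/-! ## §1 The partial Neumann sums against `g` -/

/-- **`∫ S_N g w = Σ_{k<N} C(k) rᵏ`** for the partial Neumann sum `S_N = Σ_{k<N} rᵏ Kᵏ g`. -/
theorem integral_neumann_mul
    (hAi : ∀ ⦃f h : X → ℝ⦄, A f → A h → Integrable (fun x => f x * h x * w x) μ)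
    (hAK : ∀ ⦃f : X → ℝ⦄, A f → A (K f)) {g : X → ℝ} (hg : A g) (r : ℝ) (N : ℕ) :
    ∫ x, (∑ k ∈ Finset.range N, r ^ k * (K^[k] g) x) * g x * w x ∂μ
      = ∑ k ∈ Finset.range N, (∫ x, g x * (K^[k] g) x * w x ∂μ) * r ^ k := by
  rw [integral_sum_mul hAi (fun k => iterate_mem hAK k hg) hg (fun k => r ^ k) N]
  refine Finset.sum_congr rfl fun k _ => ?_
  have e : ∫ x, (K^[k] g) x * g x * w x ∂μ = ∫ x, g x * (K^[k] g) x * w x ∂μ :=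
    integral_congr_ae (Eventually.of_forall fun x => by ring)
  rw [e, mul_comm]

/-- `∫ g S_N w = Σ_{k<N} C(k) rᵏ` (the same with `g` on the left). -/
theorem integral_mul_neumann
    (hAi : ∀ ⦃f h : X → ℝ⦄, A f → A h → Integrable (fun x => f x * h x * w x) μ)
    (hAK : ∀ ⦃f : X → ℝ⦄, A f → A (K f)) {g : X → ℝ} (hg : A g) (r : ℝ) (N : ℕ) :
    ∫ x, g x * (∑ k ∈ Finset.range N, r ^ k * (K^[k] g) x) * w x ∂μ
      = ∑ k ∈ Finset.range N, (∫ x, g x * (K^[k] g) x * w x ∂μ) * r ^ k := by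
  rw [← integral_neumann_mul hAi hAK hg r N]
  exact integral_congr_ae (Eventually.of_forall fun x => by ring)

/-- **The regularised Dirichlet form of a partial Neumann sum**:
`∫ S_N² w − r ∫ S_N (K S_N) w = Σ_{k<N} C(k) rᵏ − r^N Σ_{k<N} C(N+k) rᵏ` (every real `r`; the
resolvent identity `S_N − r K S_N = g − r^N K^N g`, symmetry and the two-time form). -/
theorem neumann_quadForm_eq
    (hAi : ∀ ⦃f h : X → ℝ⦄, A f → A h → Integrable (fun x => f x * h x * w x) μ)
    (hAc : ∀ ⦃f h : X → ℝ⦄ (c : ℝ), A f → A h → A (fun x => f x + c * h x))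
    (hAK : ∀ ⦃f : X → ℝ⦄, A f → A (K f))
    (hlin : ∀ ⦃f h : X → ℝ⦄ (c : ℝ), A f → A h →
      ∀ x, K (fun s => f s + c * h s) x = K f x + c * K h x)
    (hsymm : ∀ ⦃f h : X → ℝ⦄, A f → A h →
      ∫ x, K f x * h x * w x ∂μ = ∫ x, f x * K h x * w x ∂μ)
    {g : X → ℝ} (hg : A g) (r : ℝ) (N : ℕ) :
    (∫ x, (∑ k ∈ Finset.range N, r ^ k * (K^[k] g) x) ^ 2 * w x ∂μ)
        - r * ∫ x, (∑ k ∈ Finset.range N, r ^ k * (K^[k] g) x)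
          * K (fun y => ∑ k ∈ Finset.range N, r ^ k * (K^[k] g) y) x * w x ∂μ
      = (∑ k ∈ Finset.range N, (∫ x, g x * (K^[k] g) x * w x ∂μ) * r ^ k)
        - r ^ N * ∑ k ∈ Finset.range N, (∫ x, g x * (K^[N + k] g) x * w x ∂μ) * r ^ k := by
  set C : ℕ → ℝ := fun k => ∫ x, g x * (K^[k] g) x * w x ∂μ with hC
  have hS := neumann_mem hAc hAK hg r N
  have hgN := iterate_mem hAK N hg
  have iSg := hAi hS hg
  have iSN := hAi hS hgN
  have iS2 : Integrable (fun x => (∑ k ∈ Finset.range N, r ^ k * (K^[k] g) x) ^ 2 * w x) μ :=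
    integrable_sq_mul hAi hS
  have iSKS := hAi hS (hAK hS)
  rw [← integral_const_mul, ← integral_sub iS2 (iSKS.const_mul r)]
  have e : ∀ x, (∑ k ∈ Finset.range N, r ^ k * (K^[k] g) x) ^ 2 * w x
      - r * ((∑ k ∈ Finset.range N, r ^ k * (K^[k] g) x)
        * K (fun y => ∑ k ∈ Finset.range N, r ^ k * (K^[k] g) y) x * w x)
      = (∑ k ∈ Finset.range N, r ^ k * (K^[k] g) x) * g x * w x
        - r ^ N * ((∑ k ∈ Finset.range N, r ^ k * (K^[k] g) x) * (K^[N] g) x * w x) := by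
    intro x
    have hres := neumann_sub_op hAc hAK hlin hg r N x
    have : (∑ k ∈ Finset.range N, r ^ k * (K^[k] g) x) ^ 2 * w x
        - r * ((∑ k ∈ Finset.range N, r ^ k * (K^[k] g) x)
          * K (fun y => ∑ k ∈ Finset.range N, r ^ k * (K^[k] g) y) x * w x)
        = (∑ k ∈ Finset.range N, r ^ k * (K^[k] g) x)
          * ((∑ k ∈ Finset.range N, r ^ k * (K^[k] g) x)
            - r * K (fun y => ∑ k ∈ Finset.range N, r ^ k * (K^[k] g) y) x) * w x := by ring
    rw [this, hres]
    ring
  rw [integral_congr_ae (Eventually.of_forall e), integral_sub iSg (iSN.const_mul _),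
    integral_const_mul, integral_neumann_mul hAi hAK hg r N,
    integral_sum_mul hAi (fun k => iterate_mem hAK k hg) hgN (fun k => r ^ k) N]
  have e2 : ∀ k ∈ Finset.range N,
      r ^ k * ∫ x, (K^[k] g) x * (K^[N] g) x * w x ∂μ = C (N + k) * r ^ k := by
    intro k _
    rw [two_time hAK hsymm hg k N, show k + N = N + k by ring, mul_comm]
  rw [Finset.sum_congr rfl e2]

/-- `∫ S_N g w → A_r(g) = Σ_k C(k) rᵏ` as `N → ∞` (`0 ≤ r < 1`). -/
theorem tendsto_integral_neumann_mul (hw0 : ∀ x, 0 ≤ w x)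
    (hAi : ∀ ⦃f h : X → ℝ⦄, A f → A h → Integrable (fun x => f x * h x * w x) μ)
    (hAK : ∀ ⦃f : X → ℝ⦄, A f → A (K f))
    (hcontr : ∀ ⦃f : X → ℝ⦄, A f → ∫ x, K f x ^ 2 * w x ∂μ ≤ ∫ x, f x ^ 2 * w x ∂μ)
    {g : X → ℝ} (hg : A g) {r : ℝ} (hr0 : 0 ≤ r) (hr1 : r < 1) :
    Tendsto (fun N : ℕ => ∫ x, (∑ k ∈ Finset.range N, r ^ k * (K^[k] g) x) * g x * w x ∂μ) atTop
      (𝓝 (∑' k, (∫ x, g x * (K^[k] g) x * w x ∂μ) * r ^ k)) := by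
  have h := (summable_autocov_mul_pow hw0 hAi hAK hcontr hg hr0 hr1).hasSum.tendsto_sum_nat
  exact h.congr fun N => (integral_neumann_mul hAi hAK hg r N).symm

/-- **`Q_r(S_N) → A_r(g)`** as `N → ∞` (`0 ≤ r < 1`): the correction `r^N Σ_{k<N} C(N+k) rᵏ` is at
most `N r^N C(0) → 0`. -/
theorem tendsto_neumann_quadForm (hw0 : ∀ x, 0 ≤ w x)
    (hAi : ∀ ⦃f h : X → ℝ⦄, A f → A h → Integrable (fun x => f x * h x * w x) μ)
    (hAc : ∀ ⦃f h : X → ℝ⦄ (c : ℝ), A f → A h → A (fun x => f x + c * h x))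
    (hAK : ∀ ⦃f : X → ℝ⦄, A f → A (K f))
    (hlin : ∀ ⦃f h : X → ℝ⦄ (c : ℝ), A f → A h →
      ∀ x, K (fun s => f s + c * h s) x = K f x + c * K h x)
    (hsymm : ∀ ⦃f h : X → ℝ⦄, A f → A h →
      ∫ x, K f x * h x * w x ∂μ = ∫ x, f x * K h x * w x ∂μ)
    (hcontr : ∀ ⦃f : X → ℝ⦄, A f → ∫ x, K f x ^ 2 * w x ∂μ ≤ ∫ x, f x ^ 2 * w x ∂μ)
    {g : X → ℝ} (hg : A g) {r : ℝ} (hr0 : 0 ≤ r) (hr1 : r < 1) :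
    Tendsto (fun N : ℕ => (∫ x, (∑ k ∈ Finset.range N, r ^ k * (K^[k] g) x) ^ 2 * w x ∂μ)
        - r * ∫ x, (∑ k ∈ Finset.range N, r ^ k * (K^[k] g) x)
          * K (fun y => ∑ k ∈ Finset.range N, r ^ k * (K^[k] g) y) x * w x ∂μ) atTop
      (𝓝 (∑' k, (∫ x, g x * (K^[k] g) x * w x ∂μ) * r ^ k)) := by
  set C : ℕ → ℝ := fun k => ∫ x, g x * (K^[k] g) x * w x ∂μ with hC
  set P := ∫ x, g x ^ 2 * w x ∂μ with hP
  have hP0 : 0 ≤ P := integral_nonneg fun x => mul_nonneg (sq_nonneg _) (hw0 x)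
  have hCabs : ∀ k, |C k| ≤ P := fun k => abs_autocov_le hw0 hAi hAK hcontr hg k
  have hNrN : Tendsto (fun N : ℕ => (N : ℝ) * r ^ N) atTop (𝓝 0) :=
    tendsto_self_mul_const_pow_of_lt_one hr0 hr1
  have h2 : Tendsto (fun N : ℕ => r ^ N * ∑ k ∈ Finset.range N, C (N + k) * r ^ k) atTop (𝓝 0) := by
    have hb : Tendsto (fun N : ℕ => P * ((N : ℝ) * r ^ N)) atTop (𝓝 0) := by
      simpa using hNrN.const_mul P
    refine squeeze_zero_norm (fun N => ?_) hb
    rw [norm_mul, norm_pow, Real.norm_eq_abs, Real.norm_eq_abs, abs_of_nonneg hr0]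
    have hsum : |∑ k ∈ Finset.range N, C (N + k) * r ^ k| ≤ (N : ℝ) * P := by
      calc |∑ k ∈ Finset.range N, C (N + k) * r ^ k|
          ≤ ∑ k ∈ Finset.range N, |C (N + k) * r ^ k| := Finset.abs_sum_le_sum_abs _ _
        _ ≤ ∑ k ∈ Finset.range N, P := by
            refine Finset.sum_le_sum fun k _ => ?_
            rw [abs_mul, abs_of_nonneg (pow_nonneg hr0 k)]
            calc |C (N + k)| * r ^ k ≤ P * 1 :=
                  mul_le_mul (hCabs _) (pow_le_one₀ hr0 hr1.le) (pow_nonneg hr0 k) hP0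
              _ = P := mul_one P
        _ = (N : ℝ) * P := by simp
    calc r ^ N * |∑ k ∈ Finset.range N, C (N + k) * r ^ k| ≤ r ^ N * ((N : ℝ) * P) :=
          mul_le_mul_of_nonneg_left hsum (pow_nonneg hr0 N)
      _ = P * ((N : ℝ) * r ^ N) := by ring
  have h3 : Tendsto (fun N : ℕ => ∑ k ∈ Finset.range N, C k * r ^ k) atTop
      (𝓝 (∑' k, C k * r ^ k)) :=
    (summable_autocov_mul_pow hw0 hAi hAK hcontr hg hr0 hr1).hasSum.tendsto_sum_nat
  have h := h3.sub h2
  rw [sub_zero] at h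
  exact h.congr fun N => (neumann_quadForm_eq hAi hAc hAK hlin hsymm hg r N).symm

/-! ## §2 The variational formula in Abel form: the supremum is the Abel sum -/

/-- **LEAST-CONSTANT CHARACTERISATION OF THE ABEL SUM.**  If `0 ≤ B` and
`(∫ g v w)² ≤ B · (∫ v² w − r ∫ v (K v) w)` for EVERY `v ∈ A`, then `Σ_k C_g(k) rᵏ ≤ B`
(`0 ≤ r < 1`).  Proof: test at `v = S_N` and let `N → ∞`: `A_r(g)² ≤ B · A_r(g)`. -/
theorem abelSum_le_of_forall_sq_inner_le (hw0 : ∀ x, 0 ≤ w x)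
    (hAi : ∀ ⦃f h : X → ℝ⦄, A f → A h → Integrable (fun x => f x * h x * w x) μ)
    (hAc : ∀ ⦃f h : X → ℝ⦄ (c : ℝ), A f → A h → A (fun x => f x + c * h x))
    (hAK : ∀ ⦃f : X → ℝ⦄, A f → A (K f))
    (hlin : ∀ ⦃f h : X → ℝ⦄ (c : ℝ), A f → A h →
      ∀ x, K (fun s => f s + c * h s) x = K f x + c * K h x)
    (hsymm : ∀ ⦃f h : X → ℝ⦄, A f → A h →
      ∫ x, K f x * h x * w x ∂μ = ∫ x, f x * K h x * w x ∂μ)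
    (hcontr : ∀ ⦃f : X → ℝ⦄, A f → ∫ x, K f x ^ 2 * w x ∂μ ≤ ∫ x, f x ^ 2 * w x ∂μ)
    {g : X → ℝ} (hg : A g) {r : ℝ} (hr0 : 0 ≤ r) (hr1 : r < 1) {B : ℝ} (hB : 0 ≤ B)
    (h : ∀ ⦃v : X → ℝ⦄, A v → (∫ x, g x * v x * w x ∂μ) ^ 2
        ≤ B * ((∫ x, v x ^ 2 * w x ∂μ) - r * ∫ x, v x * K v x * w x ∂μ)) :
    ∑' k, (∫ x, g x * (K^[k] g) x * w x ∂μ) * r ^ k ≤ B := by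
  set Ar := ∑' k, (∫ x, g x * (K^[k] g) x * w x ∂μ) * r ^ k with hAr
  have hL : Tendsto (fun N : ℕ =>
      (∫ x, g x * (∑ k ∈ Finset.range N, r ^ k * (K^[k] g) x) * w x ∂μ) ^ 2) atTop
      (𝓝 (Ar ^ 2)) := by
    have ht := tendsto_integral_neumann_mul hw0 hAi hAK hcontr hg hr0 hr1
    have ht' : Tendsto (fun N : ℕ =>
        ∫ x, g x * (∑ k ∈ Finset.range N, r ^ k * (K^[k] g) x) * w x ∂μ) atTop (𝓝 Ar) :=
      ht.congr fun N => by
        rw [integral_neumann_mul hAi hAK hg r N, integral_mul_neumann hAi hAK hg r N]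
    exact ht'.pow 2
  have hR := (tendsto_neumann_quadForm hw0 hAi hAc hAK hlin hsymm hcontr hg hr0 hr1).const_mul B
  have hstep : ∀ N : ℕ,
      (∫ x, g x * (∑ k ∈ Finset.range N, r ^ k * (K^[k] g) x) * w x ∂μ) ^ 2
        ≤ B * ((∫ x, (∑ k ∈ Finset.range N, r ^ k * (K^[k] g) x) ^ 2 * w x ∂μ)
          - r * ∫ x, (∑ k ∈ Finset.range N, r ^ k * (K^[k] g) x)
            * K (fun y => ∑ k ∈ Finset.range N, r ^ k * (K^[k] g) y) x * w x ∂μ) :=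
    fun N => h (neumann_mem hAc hAK hg r N)
  have hlim : Ar ^ 2 ≤ B * Ar := le_of_tendsto_of_tendsto' hL hR hstep
  rcases le_or_gt Ar 0 with hA | hA
  · exact hA.trans hB
  · nlinarith

/-- Each trial ratio is bounded by the Abel sum: `(∫ g v w)²/Q_r(v) ≤ A_r(g)` for `v ∈ A` (Lean's
`x/0 = 0` covers the degenerate `Q_r(v) = 0`). -/
theorem sq_inner_div_quadForm_le_abelSum (hw0 : ∀ x, 0 ≤ w x)
    (hAi : ∀ ⦃f h : X → ℝ⦄, A f → A h → Integrable (fun x => f x * h x * w x) μ)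
    (hAc : ∀ ⦃f h : X → ℝ⦄ (c : ℝ), A f → A h → A (fun x => f x + c * h x))
    (hAK : ∀ ⦃f : X → ℝ⦄, A f → A (K f))
    (hlin : ∀ ⦃f h : X → ℝ⦄ (c : ℝ), A f → A h →
      ∀ x, K (fun s => f s + c * h s) x = K f x + c * K h x)
    (hsymm : ∀ ⦃f h : X → ℝ⦄, A f → A h →
      ∫ x, K f x * h x * w x ∂μ = ∫ x, f x * K h x * w x ∂μ)
    (hcontr : ∀ ⦃f : X → ℝ⦄, A f → ∫ x, K f x ^ 2 * w x ∂μ ≤ ∫ x, f x ^ 2 * w x ∂μ)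
    {g v : X → ℝ} (hg : A g) (hv : A v) {r : ℝ} (hr0 : 0 ≤ r) (hr1 : r < 1) :
    (∫ x, g x * v x * w x ∂μ) ^ 2 / ((∫ x, v x ^ 2 * w x ∂μ) - r * ∫ x, v x * K v x * w x ∂μ)
      ≤ ∑' k, (∫ x, g x * (K^[k] g) x * w x ∂μ) * r ^ k := by
  have hmain := sq_inner_le_abelSum_mul_quadForm hw0 hAi hAc hAK hlin hsymm hcontr hg hv hr0 hr1
  have hQ0 := quadForm_nonneg hw0 hAi hAK hcontr hv hr0 hr1.le
  have hA0 := abelSum_nonneg hw0 hAi hAK hsymm hcontr hg hr0 hr1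
  rcases eq_or_lt_of_le hQ0 with hz | hQpos
  · rw [← hz, div_zero]
    exact hA0
  · rw [div_le_iff₀ hQpos]
    exact hmain

/-- **THE VARIATIONAL FORMULA, ABEL FORM — EQUALITY.**  For a reversible sampler in the `RevOp`
format, every `g ∈ A` and every `0 ≤ r < 1`:
`Σ_{k≥0} C_g(k) rᵏ = ⨆_{v ∈ A} (∫ g v w)² / (∫ v² w − r ∫ v (K v) w)`.
The supremum is approached along the partial Neumann sums `S_N = Σ_{k<N} rᵏ Kᵏ g`. -/
theorem abelSum_eq_iSup (hw0 : ∀ x, 0 ≤ w x)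
    (hAi : ∀ ⦃f h : X → ℝ⦄, A f → A h → Integrable (fun x => f x * h x * w x) μ)
    (hAc : ∀ ⦃f h : X → ℝ⦄ (c : ℝ), A f → A h → A (fun x => f x + c * h x))
    (hAK : ∀ ⦃f : X → ℝ⦄, A f → A (K f))
    (hlin : ∀ ⦃f h : X → ℝ⦄ (c : ℝ), A f → A h →
      ∀ x, K (fun s => f s + c * h s) x = K f x + c * K h x)
    (hsymm : ∀ ⦃f h : X → ℝ⦄, A f → A h →
      ∫ x, K f x * h x * w x ∂μ = ∫ x, f x * K h x * w x ∂μ)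
    (hcontr : ∀ ⦃f : X → ℝ⦄, A f → ∫ x, K f x ^ 2 * w x ∂μ ≤ ∫ x, f x ^ 2 * w x ∂μ)
    {g : X → ℝ} (hg : A g) {r : ℝ} (hr0 : 0 ≤ r) (hr1 : r < 1) :
    ∑' k, (∫ x, g x * (K^[k] g) x * w x ∂μ) * r ^ k
      = ⨆ v : {v : X → ℝ // A v}, (∫ x, g x * v.1 x * w x ∂μ) ^ 2
          / ((∫ x, v.1 x ^ 2 * w x ∂μ) - r * ∫ x, v.1 x * K v.1 x * w x ∂μ) := by
  set Ar := ∑' k, (∫ x, g x * (K^[k] g) x * w x ∂μ) * r ^ k with hAr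
  set R : {v : X → ℝ // A v} → ℝ := fun v => (∫ x, g x * v.1 x * w x ∂μ) ^ 2
      / ((∫ x, v.1 x ^ 2 * w x ∂μ) - r * ∫ x, v.1 x * K v.1 x * w x ∂μ) with hRdef
  haveI : Nonempty {v : X → ℝ // A v} := ⟨⟨g, hg⟩⟩
  have hle : ∀ v : {v : X → ℝ // A v}, R v ≤ Ar := fun v =>
    sq_inner_div_quadForm_le_abelSum hw0 hAi hAc hAK hlin hsymm hcontr hg v.2 hr0 hr1
  have hbdd : BddAbove (Set.range R) := ⟨Ar, by rintro _ ⟨v, rfl⟩; exact hle v⟩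
  refine le_antisymm ?_ (ciSup_le hle)
  -- `Ar ≤ ⨆ R`: along the Neumann sums the ratio tends to `Ar` (or `Ar = 0 ≤ R g`)
  have hA0 := abelSum_nonneg hw0 hAi hAK hsymm hcontr hg hr0 hr1
  rcases eq_or_lt_of_le hA0 with hz | hApos
  · -- `Ar = 0`
    have hRg : 0 ≤ R ⟨g, hg⟩ := by
      simp only [hRdef]
      exact div_nonneg (sq_nonneg _) (quadForm_nonneg hw0 hAi hAK hcontr hg hr0 hr1.le)
    have hz' : Ar = 0 := by rw [hAr]; exact hz.symm
    rw [hz']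
    exact hRg.trans (le_ciSup hbdd ⟨g, hg⟩)
  · have hnum : Tendsto (fun N : ℕ =>
        (∫ x, g x * (∑ k ∈ Finset.range N, r ^ k * (K^[k] g) x) * w x ∂μ) ^ 2) atTop
        (𝓝 (Ar ^ 2)) := by
      have ht := tendsto_integral_neumann_mul hw0 hAi hAK hcontr hg hr0 hr1
      have ht' : Tendsto (fun N : ℕ =>
          ∫ x, g x * (∑ k ∈ Finset.range N, r ^ k * (K^[k] g) x) * w x ∂μ) atTop (𝓝 Ar) :=
        ht.congr fun N => by
          rw [integral_neumann_mul hAi hAK hg r N, integral_mul_neumann hAi hAK hg r N]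
      exact ht'.pow 2
    have hden := tendsto_neumann_quadForm hw0 hAi hAc hAK hlin hsymm hcontr hg hr0 hr1
    have hratio := hnum.div hden hApos.ne'
    have e : Ar ^ 2 / Ar = Ar := by rw [sq, mul_div_assoc, div_self hApos.ne', mul_one]
    rw [e] at hratio
    refine le_of_tendsto' hratio fun N => ?_
    exact le_ciSup hbdd ⟨_, neumann_mem hAc hAK hg r N⟩

end RevOp

end Summit.Ventures.LatticeQCDFlow.Exactness
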